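import Mathlib
import HarnessLib

/-!
# [OURS · L1 W4.5(b) · EL♮(3) · door ν4, brick N-0, core W5b helper H3] dual derivations of an affine frame of `O[x₁,…,xₙ]`

res-L1-w45b-stub-4 g13, helper H3 NAMED by the W5b pen res-L1-w45b-stub-2 g18 (bus 2026-08-29T02:22:09Z; desk WORD g25-13: stub-4 = named
helper hand).  `--supports stmt-ResolutionOfSingularities-20148 --as helper`, counted 0.  Pure commutative algebra (`import Mathlib`); no scheme,
nothing of the crux and nothing of [Hironaka2017] is asserted; EL♮(3) is NOT proved.

STATEMENT.  `F_l := Σ_{m} M_{l m} x_m + c_l` (`l < n`) affine-linear forms over a commutative ring `O`, a point `a ∈ Oⁿ` with `F_l(a) = 0` for all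
`l`, and every `x_m − a_m` in the ideal `(F_1,…,F_n)`.  Then there are derivations `E_1,…,E_n` of `O[x]` (over `ℤ`) DUAL to the frame:
`E_j F_l = [j = l]`.

PROOF.  Write `x_m − a_m = Σ_l p_{m l} F_l`; apply `∂/∂x_j` and evaluate at `a`: the Leibniz cross terms carry a factor `F_l(a) = 0`, and
`∂_j F_l = M_{l j}`, so `[j = m] = Σ_l p_{m l}(a) M_{l j}`, i.e. `P · M = 1` with `P_{m l} := p_{m l}(a)`; hence `M · P = 1` (square matrices over a
commutative ring are Dedekind-finite) and `E_j := Σ_m P_{m j} ∂/∂x_m` has `E_j F_l = Σ_m M_{l m} P_{m j} = [l = j]`. [folklore; OURS]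
-/

set_option linter.dupNamespace false -- mandated namespace `Summit.<Summit>.<Problem>` of this single-conjunct summit

noncomputable section

open MvPolynomial

namespace Summit.ResolutionOfSingularities.ResolutionOfSingularities.Cruxes.EquisingularLiftNat.Sections.Equinodal.SectionFrame

/-- Evaluation of an affine-linear form `Σ_m M_{l m} x_m + c_l` at a point. [folklore] -/
theorem eval_affineForm {O : Type} [CommRing O] {n : ℕ} (M : Matrix (Fin n) (Fin n) O) (c b : Fin n → O) (l : Fin n) :
    eval b (∑ m' : Fin n, C (M l m') * X m' + C (c l) : MvPolynomial (Fin n) O) = ∑ m, M l m * b m + c l := by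
  simp only [map_add, map_sum, map_mul, eval_C, eval_X]

/-- The partial derivative of an affine-linear form is its (constant) coefficient: `∂_j (Σ_m M_{l m} x_m + c_l) = M_{l j}`. [folklore] -/
theorem pderiv_affineForm {O : Type} [CommRing O] {n : ℕ} (M : Matrix (Fin n) (Fin n) O) (c : Fin n → O) (j l : Fin n) :
    pderiv j (∑ m' : Fin n, C (M l m') * X m' + C (c l) : MvPolynomial (Fin n) O) = C (M l j) := by
  classical
  simp only [map_add, map_sum, pderiv_C_mul, pderiv_C, add_zero, pderiv_X]
  rw [Finset.sum_eq_single j]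
  · simp
  · intro m _ hm
    simp [Ne.symm hm]
  · intro h; exact absurd (Finset.mem_univ j) h

/-- ★ H3 **DUAL DERIVATIONS OF AN AFFINE FRAME.**  If the affine-linear forms `F_l = Σ_m M_{l m} x_m + c_l` (`l < n`) all vanish at `a` and
generate an ideal containing every `x_m − a_m`, then `O[x₁,…,xₙ]` carries derivations `E_1,…,E_n` with `E_j F_l = [j = l]` — the Jacobian `M` is
invertible (`P·M = 1` by differentiating `x_m − a_m = Σ_l p_{ml} F_l` at `a`, hence `M·P = 1`) and `E_j := Σ_m P_{m j} ∂/∂x_m`.  Named by the W5b pen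
(stub-2 g18) for the frame `(L̃', ū, v̄)` of ✓ `span_X_sub_eq_span_frame`. [folklore; OURS · helper H3; counted 0] -/
theorem exists_dual_derivations_of_affine_frame {O : Type} [CommRing O] {n : ℕ} (M : Matrix (Fin n) (Fin n) O) (c a : Fin n → O)
    (hFa : ∀ l, ∑ m, M l m * a m + c l = 0)
    (hspan : ∀ m, (MvPolynomial.X m - MvPolynomial.C (a m) : MvPolynomial (Fin n) O) ∈
      Ideal.span (Set.range fun l => (∑ m', MvPolynomial.C (M l m') * MvPolynomial.X m' + MvPolynomial.C (c l) :
        MvPolynomial (Fin n) O))) :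
    ∃ E : Fin n → Derivation ℤ (MvPolynomial (Fin n) O) (MvPolynomial (Fin n) O),
      ∀ j l, E j (∑ m', MvPolynomial.C (M l m') * MvPolynomial.X m' + MvPolynomial.C (c l)) = if j = l then 1 else 0 := by
  classical
  -- the frame forms
  set F : Fin n → MvPolynomial (Fin n) O := fun l => ∑ m' : Fin n, C (M l m') * X m' + C (c l) with hFdef
  have hF0 : ∀ l, eval a (F l) = 0 := fun l => by rw [hFdef]; dsimp only; rw [eval_affineForm]; exact hFa l
  have hdF : ∀ j l, pderiv j (F l) = C (M l j) := fun j l => by rw [hFdef]; dsimp only; rw [pderiv_affineForm]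
  -- `x_m − a_m = Σ_l p m l * F l`
  have hex : ∀ m, ∃ p : Fin n → MvPolynomial (Fin n) O, ∑ l, p l * F l = X m - C (a m) := fun m =>
    Ideal.mem_span_range_iff_exists_fun.mp (hspan m)
  choose p hp using hex
  -- `P · M = 1` with `P m l := (p m l)(a)`
  set P : Matrix (Fin n) (Fin n) O := fun m l => eval a (p m l) with hPdef
  have hPM : P * M = 1 := by
    ext m j
    have h1 : eval a (pderiv j (∑ l, p m l * F l)) = ∑ l, P m l * M l j := by
      simp only [map_sum, Derivation.leibniz, smul_eq_mul, map_add, map_mul, hdF, eval_C, hF0, zero_mul, add_zero]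
      rfl
    have h2 : eval a (pderiv j (X m - C (a m) : MvPolynomial (Fin n) O)) = if m = j then 1 else 0 := by
      simp only [map_sub, pderiv_C, sub_zero, pderiv_X]
      by_cases hmj : m = j
      · subst hmj; simp
      · rw [if_neg hmj, Pi.single_apply, if_neg hmj, map_zero]
    rw [Matrix.mul_apply, Matrix.one_apply, ← h1, hp m, h2]
  have hMP : M * P = 1 := mul_eq_one_comm.mp hPM
  -- the dual derivations
  refine ⟨fun j => ∑ m, (C (P m j) : MvPolynomial (Fin n) O) • (pderiv m).restrictScalars ℤ, fun j l => ?_⟩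
  have happ : (∑ m, (C (P m j) : MvPolynomial (Fin n) O) • ((pderiv m).restrictScalars ℤ :
      Derivation ℤ (MvPolynomial (Fin n) O) (MvPolynomial (Fin n) O))) (F l) = ∑ m, C (P m j) * pderiv m (F l) := by
    induction (Finset.univ : Finset (Fin n)) using Finset.induction_on with
    | empty => simp
    | insert i s hi ih => rw [Finset.sum_insert hi, Finset.sum_insert hi, Derivation.add_apply, ih]; rfl
  change (∑ m, (C (P m j) : MvPolynomial (Fin n) O) • ((pderiv m).restrictScalars ℤ :
      Derivation ℤ (MvPolynomial (Fin n) O) (MvPolynomial (Fin n) O))) (F l) = _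
  rw [happ]
  simp only [hdF, ← map_mul, ← map_sum]
  have hentry : ∑ m, P m j * M l m = (M * P) l j := by
    rw [Matrix.mul_apply]; exact Finset.sum_congr rfl fun m _ => mul_comm _ _
  rw [hentry, hMP, Matrix.one_apply]
  by_cases hjl : j = l
  · subst hjl; simp
  · rw [if_neg (Ne.symm hjl), if_neg hjl, map_zero]

end Summit.ResolutionOfSingularities.ResolutionOfSingularities.Cruxes.EquisingularLiftNat.Sections.Equinodal.SectionFrame

end
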